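import Summits.Ventures.HSemireg.WedgeWeilPairs

/-!
# Venture HSemireg — THEOREM R-B in the wedge model (3/9)

HONEST FRAMING. Part of the Lean index of the computation cell `pub-hsemireg` (seat p3; Sunday enclosure of the
FORMULA-N kernel assets of seats th-7 / th-6, ENCLOSURE-PLAN-p3.md).  Finite-dimensional exterior algebra over a field ONLY:
no variety, no cohomology theory, no semiregularity map is constructed here; nothing here says that HC / HC_CM / HC_AV holds;
no Literature fact is declared or used.  The geometric DICTIONARY (why these ranks are the `HT`-side box ranks of the cell's
STRUCTURE.md §1 / theory/FORMULA-N.md) lives in theory/FORMULA-N-th7.md PART B §A.3 / §N and is NOT asserted in Lean.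

THEOREM R-B (FORMULA-N PART B §L.3 / §L.8; STRUCTURE D9, (F1) Weil-frame clause, C16) in the SIGN-FREE transposed wedge model — theory/th7/WeilRank.lean v3 sha256/16 7e5d6bad1a94e25a (th-7 g4, 18:46Z; ×2 farm th-2 g20 18:48:20Z); PART R/R2/R3 = l.1506–3436 on top of HankelRank v1 (= the tree's Wedge/WedgeHankel* files), VERBATIM up
to namespaces (`HSemiregWeil` ↦ `Summit.Ventures.HSemireg.Wedge.Weil`, which sees the wedge-model infrastructure `….Wedge` and opens `….Wedge.Hankel`), file 3 of 9.
MODEL: `N` pairs of generators `x_c`, `y_c`; the h-part `f = w_N(q)` (HankelRank); the «Weil vectors» `w₊ = E_{G₋}`, `w₋ = E_{G₊}` = the full monomials on the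
generator blocks of the last `N − p` / first `p` pairs (signature `(p, N − p)`; THEOREM R is `N = 2n`, `p = n`).  HEADLINES (files 5, 8, 9): `weilRank` /
`weilRank_nn` («rank(⌟v ∣ HT²) = (4 + ρ)·n² − 2n», `v = f + a w₊ + b w₋`, `ab ≠ 0`, `n ≥ 3`, ρ = rank H₂(q)), `ker_eq` (kernel = mixed 2-forms killing `f`),
`weilRank_deg` / `weilRank_nn_deg` (every degree `m`, `m + 1 ≤ N − p`), `weilRank_one` / `weilRank_nn_one` (one-sided, ε = 1).  No permutation sign is evaluated
(the pair symmetries act through `AlternatingMap.map_perm`; `sgn κ` is a unit).  This file: `vW = f + a w₊ + b w₋`, the mixed part `M = U₊ ⊗ U₋` of `Λ²`, the three weight windows and the SEPARATION (`θ ∧ v = 0 ⇒ θ ∧ f = θ ∧ w₊ = θ ∧ w₋ = 0`), **`ker_eq`**; the pair symmetries `dup` / `Lκ` / **`σκ`** with `σκ_f : σ_κ f = sgn κ • f`.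
-/

open Module Set Set.powersetCard Summit.Ventures.HSemireg.Wedge.Hankel

namespace Summit.Ventures.HSemireg.Wedge.Weil

variable (K : Type*) [Field K]

/-! ### The Weil class `v = f + a·w₊ + b·w₋` and the K-weight separation of `θ ∧ v` -/

section Weil

variable (N : ℕ)

/-- `v = f(h) + a·w₊ + b·w₋` in the model: `f = w_N(q)`, `w₊ = E_{G₋}`, `w₋ = E_{G₊}` (`G₊` = the first `p` pairs). -/
noncomputable def vW (p : ℕ) (q : ℕ → K) (a b : K) : HT K (In N) :=
  w K N N q + a • B K (In N) (Gm N p) + b • B K (In N) (Dm N p)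

/-- mixed degree-2 monomials: one generator in `G₊`, one in `G₋` (the model of `U₊ ⊗ U₋ ⊂ Λ²N`). -/
def Mix (p : ℕ) (s : Finset (In N)) : Prop := s.card = 2 ∧ ¬ s ⊆ Dm N p ∧ ¬ s ⊆ Gm N p

/-- `M = U₊ ⊗ U₋`, the mixed part of `HT² = Λ²N`. -/
noncomputable def M (p : ℕ) : Submodule K (HT K (In N)) := Sp K (Mix N p)

/-- degree-2 part `Λ²N`. -/
def Deg2 (s : Finset (In N)) : Prop := s ⊆ Finset.univ ∧ s.card = 2

variable {N}

/-- `Λ²` as an `Sp`. -/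
lemma Hom_univ_two : Hom K (In N) Finset.univ 2 = Sp K (Deg2 N) := rfl

/-- `M ≤ Λ²`. -/
lemma M_le_Hom (p : ℕ) : M K N p ≤ Hom K (In N) Finset.univ 2 :=
  Sp_mono fun s hs => ⟨Finset.subset_univ s, hs.1⟩

/-- the three weight windows. -/
def W0 (N p : ℕ) (r : Finset (In N)) : Prop := N - p ≤ μ p r ∧ μ p r ≤ N - p + 2
/-- weight window of `θ ∧ w₋`: `μ ≤ 2`. -/
def Wp (N p : ℕ) (r : Finset (In N)) : Prop := μ p r ≤ 2
/-- weight window of `θ ∧ w₊`: `μ ≥ 2N − 2p`. -/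
def Wm (N p : ℕ) (r : Finset (In N)) : Prop := (N + N) - (p + p) ≤ μ p r

/-- `θ ∧ f` lies in the window `W0` for `θ ∈ Λ²`. -/
lemma theta_mul_f_mem {p : ℕ} (q : ℕ → K) {θ : HT K (In N)} (hθ : θ ∈ Hom K (In N) Finset.univ 2) :
    θ * w K N N q ∈ Sp K (W0 N p) := by
  refine mul_mem_Sp (P := Deg2 N) (Q := Fsupp (N := N) p) (R := W0 N p) ?_ hθ (f_mem_Sp K p q)
  intro s t hst hs ht
  have h1 : μ p (s ∪ t) = μ p s + μ p t := μ_union hst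
  have h2 : μ p s ≤ 2 := (μ_le_card s).trans hs.2.le
  refine ⟨?_, ?_⟩ <;> rw [h1, ht.2] <;> omega

/-- `θ ∧ w₊` lies in the window `Wm` for `θ ∈ Λ²`. -/
lemma theta_mul_wplus_mem {p : ℕ} (hp : p ≤ N) {θ : HT K (In N)} (hθ : θ ∈ Hom K (In N) Finset.univ 2) :
    θ * B K (In N) (Gm N p) ∈ Sp K (Wm N p) := by
  refine mul_mem_Sp (P := Deg2 N) (Q := fun s => s = Gm N p) (R := Wm N p) ?_ hθ (B_mem_Sp rfl)
  intro s t _ _ ht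
  subst ht
  show (N + N) - (p + p) ≤ μ p (s ∪ Gm N p)
  rw [← card_Gm hp, ← μ_Gm]
  exact Finset.card_le_card (Finset.inter_subset_inter_right Finset.subset_union_right)

/-- `θ ∧ w₋` lies in the window `Wp` for `θ ∈ Λ²`. -/
lemma theta_mul_wminus_mem {p : ℕ} {θ : HT K (In N)} (hθ : θ ∈ Hom K (In N) Finset.univ 2) :
    θ * B K (In N) (Dm N p) ∈ Sp K (Wp N p) := by
  refine mul_mem_Sp (P := Deg2 N) (Q := fun s => s = Dm N p) (R := Wp N p) ?_ hθ (B_mem_Sp rfl)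
  intro s t hst hs ht
  subst ht
  show μ p (s ∪ Dm N p) ≤ 2
  rw [μ_union hst, μ_Dm, add_zero]
  exact (μ_le_card s).trans hs.2.le

/-- `θ ∧ v = θ ∧ f + a·(θ ∧ w₊) + b·(θ ∧ w₋)`. -/
lemma vW_mul_expand (p : ℕ) (q : ℕ → K) (a b : K) (θ : HT K (In N)) :
    θ * vW K N p q a b = θ * w K N N q + a • (θ * B K (In N) (Gm N p)) + b • (θ * B K (In N) (Dm N p)) := by
  rw [vW, mul_add, mul_add, mul_smul_comm, mul_smul_comm]

/-- **K-WEIGHT SEPARATION** (PART B §L.3, «weights pairwise disjoint iff n ≥ 3»): for `N − p ≥ 3`, `θ ∈ Λ²N` with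
`θ ∧ v = 0` has `θ ∧ f = 0`, `θ ∧ w₊ = 0` (if `a ≠ 0`) and `θ ∧ w₋ = 0` (if `b ≠ 0`). -/
lemma separation {p : ℕ} (hNp : 3 ≤ N - p) (q : ℕ → K) {a b : K} {θ : HT K (In N)}
    (hθ : θ ∈ Hom K (In N) Finset.univ 2) (h0 : θ * vW K N p q a b = 0) :
    θ * w K N N q = 0 ∧ (a ≠ 0 → θ * B K (In N) (Gm N p) = 0) ∧ (b ≠ 0 → θ * B K (In N) (Dm N p) = 0) := by
  classical
  have hp : p ≤ N := by omega
  have e0 := theta_mul_f_mem K (p := p) q hθ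
  have e1 := theta_mul_wplus_mem K hp hθ
  have e2 := theta_mul_wminus_mem K (p := p) hθ
  rw [vW_mul_expand] at h0
  have d01 : ∀ s, W0 N p s → ¬ Wm N p s := fun s h1 h2 => by unfold W0 at h1; unfold Wm at h2; omega
  have d02 : ∀ s, W0 N p s → ¬ Wp N p s := fun s h1 h2 => by unfold W0 at h1; unfold Wp at h2; omega
  have d12 : ∀ s, Wm N p s → ¬ Wp N p s := fun s h1 h2 => by unfold Wm at h1; unfold Wp at h2; omega
  refine ⟨?_, ?_, ?_⟩
  · have := congrArg (proj (K := K) (W0 N p)) h0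
    rwa [map_add, map_add, map_smul, map_smul, map_zero, proj_eq_self (fun s h => h) e0,
      proj_eq_zero (fun s h => fun h' => d01 s h' h) e1, proj_eq_zero (fun s h => fun h' => d02 s h' h) e2,
      smul_zero, smul_zero, add_zero, add_zero] at this
  · intro ha
    have := congrArg (proj (K := K) (Wm N p)) h0
    rwa [map_add, map_add, map_smul, map_smul, map_zero, proj_eq_zero d01 e0, proj_eq_self (fun s h => h) e1,
      proj_eq_zero (fun s h => fun h' => d12 s h' h) e2, smul_zero, zero_add, add_zero, smul_eq_zero,
      or_iff_right ha] at this
  · intro hb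
    have := congrArg (proj (K := K) (Wp N p)) h0
    rwa [map_add, map_add, map_smul, map_smul, map_zero, proj_eq_zero d02 e0,
      proj_eq_zero d12 e1, proj_eq_self (fun s h => h) e2, smul_zero, zero_add,
      zero_add, smul_eq_zero, or_iff_right hb] at this

/-- **BLOCK KERNELS** (PART B §L.3: `ker(⌟w₊) ∩ ker(⌟w₋) ∩ Λ²N = U₊ ⊗ U₋`): a degree-2 element killed by both full block
monomials is mixed. -/
lemma mem_M_of_mul_blocks_eq_zero {p : ℕ} {θ : HT K (In N)} (hθ : θ ∈ Hom K (In N) Finset.univ 2)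
    (h1 : θ * B K (In N) (Gm N p) = 0) (h2 : θ * B K (In N) (Dm N p) = 0) : θ ∈ M K N p := by
  classical
  -- step 1: the part supported inside G₊ vanishes
  set P1 : Finset (In N) → Prop := fun s => s ⊆ Dm N p with hP1
  have hsplit1 := proj_add_proj_not (K := K) P1 θ
  have hθ1 : proj (K := K) P1 θ ∈ Alg K (In N) (Dm N p) :=
    Sp_mono (fun s hs => hs.2) (proj_mem_and (P := P1) hθ)
  have hθ1' : proj (K := K) (fun s => ¬ P1 s) θ ∈ Sp K (fun s => Deg2 N s ∧ ¬ P1 s) := proj_mem_and hθ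
  have hz1' : proj (K := K) (fun s => ¬ P1 s) θ * B K (In N) (Gm N p) = 0 := by
    refine mul_B_eq_zero_of_mem_Sp (fun s hs hd => ?_) hθ1'
    obtain ⟨i, hi, hi'⟩ := Finset.not_subset.mp hs.2
    exact Finset.disjoint_left.mp hd hi (mem_Gm_of_not_mem_Dm hi')
  have hz1 : proj (K := K) P1 θ * B K (In N) (Gm N p) = 0 := by
    have := congrArg (· * B K (In N) (Gm N p)) hsplit1
    simp only [add_mul, hz1', add_zero, h1] at this
    exact this
  have hv1 : proj (K := K) P1 θ = 0 := eq_zero_of_mul_B_eq_zero K (disjoint_Dm_Gm p) hθ1 hz1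
  rw [hv1, zero_add] at hsplit1
  -- step 2: the part supported inside G₋ vanishes
  set θ' := proj (K := K) (fun s => ¬ P1 s) θ with hθ'
  set P2 : Finset (In N) → Prop := fun s => s ⊆ Gm N p with hP2
  have hsplit2 := proj_add_proj_not (K := K) P2 θ'
  have hθ2 : proj (K := K) P2 θ' ∈ Alg K (In N) (Gm N p) :=
    Sp_mono (fun s hs => hs.2) (proj_mem_and (P := P2) hθ1')
  have hθ2' : proj (K := K) (fun s => ¬ P2 s) θ' ∈ Sp K (fun s => (Deg2 N s ∧ ¬ P1 s) ∧ ¬ P2 s) :=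
    proj_mem_and hθ1'
  have hz2' : proj (K := K) (fun s => ¬ P2 s) θ' * B K (In N) (Dm N p) = 0 := by
    refine mul_B_eq_zero_of_mem_Sp (fun s hs hd => ?_) hθ2'
    obtain ⟨i, hi, hi'⟩ := Finset.not_subset.mp hs.2
    exact Finset.disjoint_left.mp hd hi (mem_Dm_of_not_mem_Gm hi')
  have hz2 : proj (K := K) P2 θ' * B K (In N) (Dm N p) = 0 := by
    have := congrArg (· * B K (In N) (Dm N p)) hsplit2
    simp only [add_mul, hz2', add_zero] at this
    rw [this, hsplit1, h2]
  have hv2 : proj (K := K) P2 θ' = 0 := eq_zero_of_mul_B_eq_zero K (disjoint_Dm_Gm p).symm hθ2 hz2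
  rw [hv2, zero_add] at hsplit2
  rw [← hsplit1, ← hsplit2]
  exact Sp_mono (fun s hs => ⟨hs.1.1.2, hs.1.2, hs.2⟩) hθ2'

/-- mixed 2-forms kill both Weil vectors. -/
lemma mul_blocks_eq_zero_of_mem_M {p : ℕ} {θ : HT K (In N)} (hθ : θ ∈ M K N p) :
    θ * B K (In N) (Gm N p) = 0 ∧ θ * B K (In N) (Dm N p) = 0 := by
  constructor
  · refine mul_B_eq_zero_of_mem_Sp (fun s hs hd => ?_) hθ
    obtain ⟨i, hi, hi'⟩ := Finset.not_subset.mp hs.2.1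
    exact Finset.disjoint_left.mp hd hi (mem_Gm_of_not_mem_Dm hi')
  · refine mul_B_eq_zero_of_mem_Sp (fun s hs hd => ?_) hθ
    obtain ⟨i, hi, hi'⟩ := Finset.not_subset.mp hs.2.2
    exact Finset.disjoint_left.mp hd hi (mem_Dm_of_not_mem_Gm hi')

/-- **(E)** the kernel of `θ ↦ θ ∧ v` on `Λ²N` is the kernel of `θ ↦ θ ∧ f` on the mixed part `M`. -/
theorem ker_eq {p : ℕ} (hNp : 3 ≤ N - p) (q : ℕ → K) {a b : K} (ha : a ≠ 0) (hb : b ≠ 0) :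
    Hom K (In N) Finset.univ 2 ⊓ LinearMap.ker (LinearMap.mulRight K (vW K N p q a b)) =
      M K N p ⊓ LinearMap.ker (LinearMap.mulRight K (w K N N q)) := by
  ext θ
  simp only [Submodule.mem_inf, LinearMap.mem_ker, LinearMap.mulRight_apply]
  constructor
  · rintro ⟨hθ, h0⟩
    obtain ⟨hf, hm, hd⟩ := separation K hNp q hθ h0
    exact ⟨mem_M_of_mul_blocks_eq_zero K hθ (hm ha) (hd hb), hf⟩
  · rintro ⟨hθ, h0⟩
    obtain ⟨hm, hd⟩ := mul_blocks_eq_zero_of_mem_M K hθ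
    refine ⟨M_le_Hom K p hθ, ?_⟩
    rw [vW_mul_expand, h0, hm, hd, smul_zero, smul_zero, add_zero, add_zero]

end Weil

/-! ### The symmetric group of the pairs acts; `f` is alternating-symmetric (`σ_κ f = sign κ · f`) -/

section Symmetry

variable (N : ℕ)

/-- the permutation of `In N` acting as `κ` on both halves (`x_c ↦ x_{κ c}`, `y_c ↦ y_{κ c}`). -/
def dup (κ : Equiv.Perm (Fin N)) : Equiv.Perm (In N) :=
  finSumFinEquiv.symm.trans ((Equiv.sumCongr κ κ).trans finSumFinEquiv)

variable {N}

/-- the pair permutation on `x_c`. -/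
@[simp] lemma dup_xJ (κ : Equiv.Perm (Fin N)) (c : Fin N) : dup N κ (xJ N c) = xJ N (κ c) := by
  rw [dup, Equiv.trans_apply, Equiv.trans_apply, xJ, xJ, finSumFinEquiv_symm_apply_castAdd,
    Equiv.sumCongr_apply, Sum.map_inl, finSumFinEquiv_apply_left]

/-- the pair permutation on `y_c`. -/
@[simp] lemma dup_yJ (κ : Equiv.Perm (Fin N)) (c : Fin N) : dup N κ (yJ N c) = yJ N (κ c) := by
  rw [dup, Equiv.trans_apply, Equiv.trans_apply, yJ, yJ, finSumFinEquiv_symm_apply_natAdd,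
    Equiv.sumCongr_apply, Sum.map_inr, finSumFinEquiv_apply_right]

/-- `dup κ` acts on pair indices by `κ`. -/
lemma pr_dup (κ : Equiv.Perm (Fin N)) (i : In N) : pr (dup N κ i) = κ (pr i) := by
  rcases eq_xJ_or_eq_yJ i with h | h <;> rw [h] <;> simp

/-- `dup κ` commutes with partners. -/
lemma dup_pt (κ : Equiv.Perm (Fin N)) (i : In N) : dup N κ (pt i) = pt (dup N κ i) := by
  rcases eq_xJ_or_eq_yJ i with h | h <;> rw [h] <;> simp

variable (N)

/-- the induced linear automorphism of `N = K^{In N}` (permutation of coordinates). -/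
noncomputable def Lκ (κ : Equiv.Perm (Fin N)) : (In N → K) ≃ₗ[K] (In N → K) :=
  LinearEquiv.funCongrLeft K K (dup N κ).symm

variable {N}

/-- the induced linear map on coordinates. -/
lemma Lκ_apply (κ : Equiv.Perm (Fin N)) (x : In N → K) (j : In N) : Lκ K N κ x j = x ((dup N κ).symm j) := rfl

/-- `Lκ` permutes the standard basis by `dup κ`. -/
lemma Lκ_b (κ : Equiv.Perm (Fin N)) (i : In N) : Lκ K N κ (b K (In N) i) = b K (In N) (dup N κ i) := by
  ext j
  rw [Lκ_apply, b, Pi.basisFun_apply, Pi.basisFun_apply, Pi.single_apply, Pi.single_apply]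
  have : (dup N κ).symm j = i ↔ j = dup N κ i := by rw [Equiv.symm_apply_eq]
  simp only [this]

variable (N)

/-- the permutation as an isometry of the zero quadratic form, and the induced algebra automorphism `σ_κ`. -/
noncomputable def isoκ (κ : Equiv.Perm (Fin N)) :
    (0 : QuadraticForm K (In N → K)).IsometryEquiv (0 : QuadraticForm K (In N → K)) :=
  { Lκ K N κ with map_app' := fun m => by simp }

/-- the algebra automorphism of `⋀` induced by the pair permutation `κ`. -/
noncomputable def σκ (κ : Equiv.Perm (Fin N)) : HT K (In N) ≃ₐ[K] HT K (In N) :=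
  CliffordAlgebra.equivOfIsometry (isoκ K N κ)

variable {N}

/-- `σκ` on generators is `Lκ`. -/
lemma σκ_ι (κ : Equiv.Perm (Fin N)) (m : In N → K) :
    σκ K N κ (ExteriorAlgebra.ι K m) = ExteriorAlgebra.ι K (Lκ K N κ m) := by
  rw [σκ, CliffordAlgebra.equivOfIsometry_apply]
  show CliffordAlgebra.map _ (CliffordAlgebra.ι _ m) = CliffordAlgebra.ι _ _
  rw [CliffordAlgebra.map_apply_ι]
  rfl

/-- `σκ` permutes the generator monomials. -/
lemma σκ_gx (κ : Equiv.Perm (Fin N)) (i : In N) : σκ K N κ (gx K i) = gx K (dup N κ i) := by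
  rw [gx_eq_ι, gx_eq_ι, σκ_ι, Lκ_b]

/-- `σκ` on `ιMulti`. -/
lemma σκ_ιMulti (κ : Equiv.Perm (Fin N)) {m : ℕ} (v : Fin m → In N → K) :
    σκ K N κ (ExteriorAlgebra.ιMulti K m v) = ExteriorAlgebra.ιMulti K m (Lκ K N κ ∘ v) := by
  rw [ExteriorAlgebra.ιMulti_apply, ExteriorAlgebra.ιMulti_apply, map_list_prod, List.map_ofFn]
  congr 1
  apply List.ofFn_inj.mpr
  funext i
  simp only [Function.comp_apply, σκ_ι]

/-- the transversal family `a ↦ (y_a if a ∈ T else x_a)` as vectors of `N`. -/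
noncomputable def vT (T : Finset (Fin N)) : Fin N → In N → K :=
  fun a => if a ∈ T then b K (In N) (yJ N a) else b K (In N) (xJ N a)

/-- `f = w_N(q) = Σ_m q_m Σ_{|T| = m} ιMulti (vT T)` (HankelRank `w_eq_G` + `G_top`). -/
lemma f_eq_sum_ιMulti (q : ℕ → K) :
    w K N N q = ∑ m ∈ Finset.range (N + 1), q m •
      ∑ T ∈ (Finset.univ : Finset (Fin N)).powersetCard m, ExteriorAlgebra.ιMulti K N (vT K T) := by
  rw [w_eq_G, G_top]
  apply Finset.sum_congr rfl
  intro m _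
  congr 1
  apply Finset.sum_congr rfl
  intro T _
  rw [ExteriorAlgebra.ιMulti_apply, List.ofFn_eq_map]
  congr 1
  apply List.map_congr_left
  intro a _
  unfold vT
  split_ifs <;> rfl

/-- `Lκ` carries the vector tuple of `T` to that of `κ(T)` (reindexed). -/
lemma Lκ_comp_vT (κ : Equiv.Perm (Fin N)) (T : Finset (Fin N)) :
    Lκ K N κ ∘ vT K T = vT K (T.map κ.toEmbedding) ∘ κ := by
  funext a
  simp only [Function.comp_apply, vT, Finset.mem_map_equiv, Equiv.symm_apply_apply]
  split_ifs <;> rw [Lκ_b] <;> simp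

/-- the unit `sign κ` as a scalar of `K`. -/
def sgn (κ : Equiv.Perm (Fin N)) : K := ((Equiv.Perm.sign κ : ℤˣ) : ℤ)

/-- the sign of a permutation is non-zero in `K`. -/
lemma sgn_ne_zero (κ : Equiv.Perm (Fin N)) : sgn (K := K) κ ≠ 0 := by
  intro h
  have h2 : sgn (K := K) κ * sgn (K := K) κ = 1 := by
    rw [sgn, ← Int.cast_mul, ← Units.val_mul, Int.units_mul_self, Units.val_one, Int.cast_one]
  rw [h, mul_zero] at h2
  exact zero_ne_one h2

/-- **ALTERNATING SYMMETRY of the h-part:** `σ_κ f = sign κ · f`. -/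
theorem σκ_f (κ : Equiv.Perm (Fin N)) (q : ℕ → K) : σκ K N κ (w K N N q) = sgn (K := K) κ • w K N N q := by
  rw [f_eq_sum_ιMulti, map_sum, Finset.smul_sum]
  apply Finset.sum_congr rfl
  intro m _
  rw [map_smul, map_sum, smul_comm (sgn (K := K) κ) (q m) _]
  congr 1
  rw [Finset.smul_sum]
  -- reindex T ↦ T.map κ
  refine Finset.sum_equiv κ.finsetCongr (fun T => ?_) (fun T _ => ?_)
  · rw [Finset.mem_powersetCard_univ, Finset.mem_powersetCard_univ, Equiv.finsetCongr_apply, Finset.card_map]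
  · rw [Equiv.finsetCongr_apply, σκ_ιMulti, Lκ_comp_vT, AlternatingMap.map_perm, sgn, Units.smul_def,
      ← Int.cast_smul_eq_zsmul K]

/-- `σ_κ` commutes with `∧ f` up to the unit `sign κ`; hence it transports images of `∧ f`. -/
lemma map_mulRight_f_map_σκ (κ : Equiv.Perm (Fin N)) (q : ℕ → K) (X : Submodule K (HT K (In N))) :
    (X.map (σκ K N κ).toLinearMap).map (LinearMap.mulRight K (w K N N q)) =
      (X.map (LinearMap.mulRight K (w K N N q))).map (σκ K N κ).toLinearMap := by
  rw [← Submodule.map_comp, ← Submodule.map_comp]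
  have h : LinearMap.mulRight K (w K N N q) ∘ₗ (σκ K N κ).toLinearMap =
      (sgn (K := K) κ)⁻¹ • ((σκ K N κ).toLinearMap ∘ₗ LinearMap.mulRight K (w K N N q)) := by
    refine LinearMap.ext fun θ => ?_
    simp only [LinearMap.coe_comp, Function.comp_apply, LinearMap.mulRight_apply, AlgEquiv.toLinearMap_apply,
      LinearMap.smul_apply, map_mul, σκ_f, mul_smul_comm, smul_smul,
      inv_mul_cancel₀ (sgn_ne_zero (K := K) κ), one_smul]
  rw [h, Submodule.map_smul _ _ _ (inv_ne_zero (sgn_ne_zero (K := K) κ))]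

/-- ranks of `(−) ∧ f` are invariant under the pair symmetries `σκ`. -/
lemma finrank_map_f_map_σκ (κ : Equiv.Perm (Fin N)) (q : ℕ → K) (X : Submodule K (HT K (In N))) :
    Module.finrank K ↥((X.map (σκ K N κ).toLinearMap).map (LinearMap.mulRight K (w K N N q))) =
      Module.finrank K ↥(X.map (LinearMap.mulRight K (w K N N q))) := by
  rw [map_mulRight_f_map_σκ]
  exact LinearEquiv.finrank_map_eq (σκ K N κ).toLinearEquiv _

end Symmetry

end Summit.Ventures.HSemireg.Wedge.Weil
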